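import Mathlib
import HarnessLib
import Summits.NavierStokesRegularity.NavierStokesRegularity.Theorems.TypeIQuarterGateScarEnvelopeTypeIForcedTsaiAlgEnclosures
import Summits.NavierStokesRegularity.NavierStokesRegularity.Theorems.TypeIQuarterGateScarEnvelopeTypeIForcedTsaiAlgSoundG

/-!
# ARM B lane E-exact, Type-I-tail class — SOUNDNESS of the v4 rows (EXACT level on `B₁₀`, exact weight):
  `AlgRowX.checkX = true → ForcedTsaiModulusLE M δ` (LANEX-ALG v4, `…ForcedTsaiAlgCertX`)

Level side: `M² ≤ encLoPi(lev2X) ≤ π·⟨lev2X⟩ = ∫_{B₁₀} |ω|² = ‖curl U‖²_{L²(B₁₀)}` by `integral_ball_poly5` (`…AlgMomentsBall`)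
and the `τ = 3` enclosures (`…AlgEnclosures`); residual side verbatim from v3 (`…AlgSoundG`: exact weight).
UPPER bounds on the forced-Tsai modulus only («near-profiles this good exist»); excludes nothing; nothing about NS
regularity; 23843 / H3 OPEN.
-/

noncomputable section

set_option linter.dupNamespace false

namespace Summit.NavierStokesRegularity.NavierStokesRegularity.Cruxes.ScarEnvelopeTypeI.ForcedTsai

open MeasureTheory Set Metric Real Finset
open scoped RealInnerProductSpace ContDiff
open Literature.Analysis.FluidPDE

namespace AlgRowX

/-- Value of `|ω|²`: `‖curl U(y)‖²`. -/
theorem eval_om2Poly (r : AlgRowX) (y : E3) :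
    Poly5.eval r.toRowG.toRow.tauR r.om2Poly y = ‖curl r.toRowG.toRow.field y‖ ^ 2 := by
  rw [AlgRowX.om2Poly, r.toRowG.toRow.curl_field y, AlgRow.norm_sq_evalVec5]

/-- **SOUNDNESS of a v4 row (exact level on `B₁₀`, exact weight)**: a passing row certifies
`ForcedTsaiModulusLE M δ` — an upper bound on the forced-Tsai modulus. -/
theorem sound (r : AlgRowX) (h : r.checkX = true) :
    ForcedTsaiModulusLE (r.M : ℝ) (r.δ : ℝ) := by
  unfold AlgRowX.checkX at h
  rcases hE : r.toRowG.res2E with _ | R <;> rcases hO : r.toRowG.res2O with _ | o <;>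
    simp only [hE, hO, Bool.and_false, Bool.and_eq_true, decide_eq_true_eq, Bool.false_eq_true] at h
  obtain ⟨⟨⟨⟨hτ3, hM⟩, hδ⟩, hlev⟩, hres⟩ := h
  have hτq : 0 < r.tau := by rw [hτ3]; norm_num
  have hτq' : 0 < r.toRowG.toRow.tau := hτq
  have hτR : 0 < r.toRowG.toRow.tauR := by unfold AlgRow.tauR AlgRowG.toRow AlgRowX.toRowG; exact_mod_cast hτq
  have hτ0 : r.toRowG.toRow.tauR ≠ 0 := hτR.ne'
  have hM' : (0 : ℝ) ≤ r.M := by exact_mod_cast hM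
  have hδ' : (0 : ℝ) ≤ r.δ := by exact_mod_cast hδ
  -- the moment packages
  obtain ⟨hintE, hIE⟩ := integral_poly5 hτq' r.toRowG.resPolyE (c := R) hE
  obtain ⟨hintO, hIO⟩ := integral_poly5_odd hτq' r.toRowG.resPolyO (c := o) hO
  obtain ⟨hintB, hIB⟩ := integral_ball_poly5 hτq r.om2Poly
  have hτcast : ((r.toRowG.toRow.tau : ℚ) : ℝ) = r.toRowG.toRow.tauR := rfl
  have hτcast' : ((r.tau : ℚ) : ℝ) = r.toRowG.toRow.tauR := rfl
  rw [hτcast] at hintE hIE hintO hIO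
  rw [hτcast'] at hintB hIB
  -- the exact residual integrand and its integral (v3)
  have hsum : Integrable (fun y : E3 => (1 + ‖y‖) ^ 5 * ‖lerayVorticityResidual r.toRowG.toRow.field y‖ ^ 2) := by
    refine (hintE.add hintO).congr (Filter.Eventually.of_forall fun y => ?_)
    rw [Pi.add_apply]
    beta_reduce
    rw [r.toRowG.weight_mul_residual_eq hτ0 y]
  have hval : ∫ y, (1 + ‖y‖) ^ 5 * ‖lerayVorticityResidual r.toRowG.toRow.field y‖ ^ 2 =
      ((R.1 + o : ℚ) : ℝ) * π + (R.2 : ℝ) * π ^ 2 := by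
    have : (fun y : E3 => (1 + ‖y‖) ^ 5 * ‖lerayVorticityResidual r.toRowG.toRow.field y‖ ^ 2) =
        fun y => Poly5.eval r.toRowG.toRow.tauR r.toRowG.resPolyE y + ‖y‖ * Poly5.eval r.toRowG.toRow.tauR r.toRowG.resPolyO y :=
      funext fun y => r.toRowG.weight_mul_residual_eq hτ0 y
    rw [this, integral_add hintE hintO, hIE, hIO]
    push_cast; ring
  refine ⟨r.toRowG.toRow.field, r.toRowG.toRow.contDiff_field, r.toRowG.toRow.isDivFree_field, ?_, hsum, ?_⟩
  · -- LEVEL, exactly: M² ≤ encLoPi ≤ π·⟨lev2X⟩ = ∫_{B₁₀} |ω|²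
    unfold lerayLevel
    refine (Real.le_sqrt hM' (integral_nonneg fun y => sq_nonneg _)).mpr ?_
    have hball : ∫ y in ball (0 : E3) 10, ‖curl r.toRowG.toRow.field y‖ ^ 2 =
        ∫ y in ball (0 : E3) 10, Poly5.eval r.toRowG.toRow.tauR r.om2Poly y :=
      setIntegral_congr_fun measurableSet_ball fun y _ => (r.eval_om2Poly y).symm
    have henc := Q4.encLoPi_le r.lev2X
    have hx : ((10 / r.tau : ℚ) : ℝ) = (((10 / (3 : ℚ) : ℚ) : ℝ)) := by rw [hτ3]
    have hlev' : (r.M : ℝ) ^ 2 ≤ (r.lev2X.encLoPi : ℝ) := by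
      have := hlev; rw [← sq] at this; exact_mod_cast this
    calc (r.M : ℝ) ^ 2 ≤ (r.lev2X.encLoPi : ℝ) := hlev'
      _ ≤ π * Q4.eval (((10 / (3 : ℚ) : ℚ) : ℝ)) r.lev2X := henc
      _ = π * Q4.eval ((10 / r.tau : ℚ) : ℝ) (Poly5.integrateBall r.tau r.om2Poly) := by rw [hx]; rfl
      _ = ∫ y in ball (0 : E3) 10, Poly5.eval r.toRowG.toRow.tauR r.om2Poly y := hIB.symm
      _ = ∫ y in ball (0 : E3) 10, ‖curl r.toRowG.toRow.field y‖ ^ 2 := hball.symm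
  · -- RESIDUAL (v3): exact value, then the enclosure
    unfold lerayResidualNorm
    rw [show (r.δ : ℝ) = Real.sqrt ((r.δ : ℝ) ^ 2) by rw [Real.sqrt_sq hδ']]
    refine Real.sqrt_le_sqrt ?_
    have hres' : (encHi (R.1 + o, R.2) : ℝ) ≤ (r.δ : ℝ) ^ 2 := by
      have := hres; rw [← sq] at this; exact_mod_cast this
    calc ∫ y, (1 + ‖y‖) ^ 5 * ‖lerayVorticityResidual r.toRowG.toRow.field y‖ ^ 2
        = ((R.1 + o : ℚ) : ℝ) * π + (R.2 : ℝ) * π ^ 2 := hval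
      _ ≤ (encHi (R.1 + o, R.2) : ℝ) := le_encHi (R.1 + o, R.2)
      _ ≤ (r.δ : ℝ) ^ 2 := hres'

/-- Soundness through the shared-evaluation form. -/
theorem sound_of_checkXs (r : AlgRowX) (h : r.checkXs = true) : ForcedTsaiModulusLE (r.M : ℝ) (r.δ : ℝ) :=
  r.sound (r.checkX_of_checkXs h)

end AlgRowX

end Summit.NavierStokesRegularity.NavierStokesRegularity.Cruxes.ScarEnvelopeTypeI.ForcedTsai

end
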